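import Summits.KontsevichZagierPeriods.Zeta5Search.TwoTaleP15LineBoundDecay
import Summits.KontsevichZagierPeriods.Zeta5Search.TwoTaleL25StripShift
import Summits.KontsevichZagierPeriods.Zeta5Search.TwoTaleL25LineRate
import Summits.KontsevichZagierPeriods.Zeta5Search.TwoTaleL25LineCertificate
import Summits.KontsevichZagierPeriods.Zeta5Search.Denom.TwoTaleP15DecayHolds

/-!
# RUNG L(2/5) `(32,27,22,37 | 0,5,10,64)`: `DecayL25 c` from the one-variable certificate — `DecayL25 71.44179` PROVED

HONEST FRAMING: systematic search; no irrationality claim unless certified.  Cell pub-zeta5 (measure-opt g0), the L(2/5)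
twin of P1's `TwoTaleD1Decay` (file T6 of the D1 programme).  No measure or irrationality claim is made here: this is
the `dy`-assembly and the final one-variable step.  With `TwoTaleL25StripShift.decayL25_of_halfLineBound` (line
representation + strip shift PROVED at L(2/5)) and the scaled line bound `TwoTaleL25Line.log_norm_RCL25_line_le`, the
decay input `Denom.TwoTaleL25Forms.DecayL25 c` of the first-tale cone point `a = (32n+1, 27n+1, 22n+1, 37n+1)`,
`b = (1, 5n+1, 10n+1, 64n+2)` follows from ONE explicit inequality for the elementary function `rateL25`:
* `lineIntegrandL25_le` — pointwise on the line `x = ⌊127n/10⌋ + ½`, for `y ≠ 0`, `n ≥ 3`: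
  `‖Rₙ(uₙ+iy)‖/cosh²(πy) ≤ 4e^{K0L25}·n²·(484+y²)⁹·e^{nM}·e^{−δ|y|}` whenever `rateL25 η − (2π−δ)|η| ≤ M` for all `η ≠ 0`;
* `integral_lineIntegrandL25_le` — integrated against P1's integrable majorant `(484+y²)⁹e^{−δ|y|}`;
* **`decayL25_of_certificate`**: `0 < δ` → `(∀ η ≠ 0, rateL25 η − (2π − δ)|η| ≤ M)` → `c < −M` → `DecayL25 c`;
* `rateL25_eq : rateL25 η = profileL250 (127/10) η` (the two normalisations agree) and, with the kernel certificate
  `TwoTaleL25LineCertificate.certL25_delta` (`δ = min 4 ((71.441797 − c)/66)`):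
  **`decayL25_of_lt : c < 71.441797 → DecayL25 c`**, `decayL25_holds_sharp : DecayL25 71.44179`,
  `decayL25_holds : DecayL25 71.4417`.
The design value of the tale-1 decay constant is `C₀ = 71.44179775` (saddle); the line `ξ = 127/10` gives
`71.44179774`; the kernel certificate `71.441797`; this file `71.44179` — total loss `8·10⁻⁶` nats.  This is an input to an
irrationality-MEASURE bound for the known-irrational `π²`; it says nothing about `ζ(5)`.
References: W. Zudilin, arXiv:1310.1526 [Zudilin2014ZetaTwo] Prop. 1, Lemma 6.
-/

noncomputable section

open Real Complex MeasureTheory Set Filter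
open Literature.NumberTheory.Irrationality.Zudilin2014
open Summit.KontsevichZagierPeriods.Zeta5Search.Denom.TwoTaleL25Forms
open Summit.KontsevichZagierPeriods.Zeta5Search.TwoTaleLineBound
open Summit.KontsevichZagierPeriods.Zeta5Search.TwoTaleL25LineRep (ratRCL25)
open Summit.KontsevichZagierPeriods.Zeta5Search.TwoTaleL25StripShift (decayL25_of_halfLineBound)
open Summit.KontsevichZagierPeriods.Zeta5Search.TwoTaleL25LineProfileShape (profileL250 profileL25Const)
open Summit.KontsevichZagierPeriods.Zeta5Search.TwoTaleL25LineCertificate (certL25_delta)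
open Summit.KontsevichZagierPeriods.Zeta5Search.Denom.TwoTaleP15DecayHolds (prim_eq_gPrim)
open Summit.KontsevichZagierPeriods.Zeta5Search.Denom.LineProfile (gPrim)

namespace Summit.KontsevichZagierPeriods.Zeta5Search.TwoTaleL25Line

variable {M δ : ℝ}

/-- **Pointwise bound on the line** (`y ≠ 0`, `n ≥ 3`), given the certificate with slope `2π − δ`. -/
theorem lineIntegrandL25_le (hcert : ∀ η : ℝ, η ≠ 0 → rateL25 η - (2 * π - δ) * |η| ≤ M) {n : ℕ} (hn : 3 ≤ n)
    {y : ℝ} (hy : y ≠ 0) :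
    ‖ratRCL25 n ((uLineL25 n : ℂ) + (y : ℂ) * I)‖ / Real.cosh (π * y) ^ 2 ≤
      4 * Real.exp K0L25 * (n : ℝ) ^ 2 * (484 + y ^ 2) ^ 9 * Real.exp (n * M) * Real.exp (-(δ * |y|)) := by
  have hn0 : (0 : ℝ) < n := by exact_mod_cast (show 0 < n by omega)
  have hn1 : (1 : ℝ) ≤ n := by exact_mod_cast (show 1 ≤ n by omega)
  obtain ⟨η, hη⟩ : ∃ η : ℝ, η = y / n := ⟨_, rfl⟩
  have hη0 : η ≠ 0 := by rw [hη]; exact div_ne_zero hy hn0.ne'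
  have hyη : (n : ℝ) * η = y := by rw [hη]; field_simp
  have hL : Real.log ‖ratRCL25 n ((uLineL25 n : ℂ) + (y : ℂ) * I)‖ ≤
      n * rateL25 η + 2 * Real.log n + 9 * Real.log (22 ^ 2 + η ^ 2) + K0L25 := by
    have h := log_norm_RCL25_line_le hη0 hn
    rw [show ((((n : ℝ) * η : ℝ) : ℂ)) = (y : ℂ) by rw [hyη]] at h
    exact h
  have hc := hcert η hη0
  -- scale the certificate: n·rateL25 η ≤ n M + (2π − δ)|y|
  have habs : (n : ℝ) * |η| = |y| := by rw [← abs_of_pos hn0, ← abs_mul, hyη]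
  have hc' : (n : ℝ) * rateL25 η ≤ n * M + (2 * π - δ) * |y| :=
    calc (n : ℝ) * rateL25 η = n * (rateL25 η - (2 * π - δ) * |η|) + (2 * π - δ) * (n * |η|) := by ring
      _ ≤ n * M + (2 * π - δ) * (n * |η|) := by gcongr
      _ = n * M + (2 * π - δ) * |y| := by rw [habs]
  -- (y/n)² ≤ y²
  have hlog : Real.log (22 ^ 2 + η ^ 2) ≤ Real.log (484 + y ^ 2) := by
    apply Real.log_le_log (by positivity)
    have : η ^ 2 ≤ y ^ 2 := by
      rw [hη, div_pow]; exact div_le_self (sq_nonneg y) (by nlinarith)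
    nlinarith
  -- log of the numerator
  have hlogR : Real.log ‖ratRCL25 n ((uLineL25 n : ℂ) + (y : ℂ) * I)‖ ≤
      n * M + (2 * π - δ) * |y| + 2 * Real.log n + 9 * Real.log (484 + y ^ 2) + K0L25 := by
    refine hL.trans ?_
    have h9 := mul_le_mul_of_nonneg_left hlog (by norm_num : (0:ℝ) ≤ 9)
    exact add_le_add (add_le_add (add_le_add hc' le_rfl) h9) le_rfl
  have hR : ‖ratRCL25 n ((uLineL25 n : ℂ) + (y : ℂ) * I)‖ ≤
      Real.exp (n * M + (2 * π - δ) * |y| + 2 * Real.log n + 9 * Real.log (484 + y ^ 2) + K0L25) := by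
    rcases eq_or_lt_of_le (norm_nonneg (ratRCL25 n ((uLineL25 n : ℂ) + (y : ℂ) * I))) with h0 | hpos
    · rw [← h0]; exact (Real.exp_pos _).le
    · exact (Real.log_le_iff_le_exp hpos).1 hlogR
  -- the kernel
  have hK : Real.exp (2 * |π * y|) / 4 ≤ Real.cosh (π * y) ^ 2 := exp_le_cosh_sq _
  have hcosh : 0 < Real.cosh (π * y) ^ 2 := by positivity
  rw [div_le_iff₀ hcosh]
  have hpy : |π * y| = π * |y| := by rw [abs_mul, abs_of_pos Real.pi_pos]
  rw [hpy] at hK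
  have hexp : Real.exp (n * M + (2 * π - δ) * |y| + 2 * Real.log n + 9 * Real.log (484 + y ^ 2) + K0L25) =
      Real.exp K0L25 * (n : ℝ) ^ 2 * (484 + y ^ 2) ^ 9 * Real.exp (n * M) * Real.exp (-(δ * |y|))
        * (Real.exp (2 * (π * |y|)) / 4) * 4 := by
    rw [show n * M + (2 * π - δ) * |y| + 2 * Real.log n + 9 * Real.log (484 + y ^ 2) + K0L25 =
      K0L25 + 2 * Real.log n + 9 * Real.log (484 + y ^ 2) + n * M + (-(δ * |y|)) + 2 * (π * |y|) by ring]
    rw [Real.exp_add, Real.exp_add, Real.exp_add, Real.exp_add, Real.exp_add]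
    rw [show (2 : ℝ) * Real.log n = Real.log ((n : ℝ) ^ 2) by rw [Real.log_pow]; push_cast; ring,
      Real.exp_log (by positivity),
      show (9 : ℝ) * Real.log (484 + y ^ 2) = Real.log ((484 + y ^ 2) ^ 9) by rw [Real.log_pow]; push_cast; ring,
      Real.exp_log (by positivity)]
    ring
  calc ‖ratRCL25 n ((uLineL25 n : ℂ) + (y : ℂ) * I)‖
      ≤ Real.exp K0L25 * (n : ℝ) ^ 2 * (484 + y ^ 2) ^ 9 * Real.exp (n * M) * Real.exp (-(δ * |y|))
          * (Real.exp (2 * (π * |y|)) / 4) * 4 := by rw [← hexp]; exact hR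
    _ ≤ Real.exp K0L25 * (n : ℝ) ^ 2 * (484 + y ^ 2) ^ 9 * Real.exp (n * M) * Real.exp (-(δ * |y|))
          * Real.cosh (π * y) ^ 2 * 4 := by gcongr
    _ = 4 * Real.exp K0L25 * (n : ℝ) ^ 2 * (484 + y ^ 2) ^ 9 * Real.exp (n * M) * Real.exp (-(δ * |y|))
          * Real.cosh (π * y) ^ 2 := by ring

/-- The integral of the majorant: `∫ Fₙ ≤ 4e^{K0L25} n² e^{nM} · ∫ (484+y²)⁹e^{−δ|y|}` (`n ≥ 3`). -/
theorem integral_lineIntegrandL25_le (hδ : 0 < δ) (hcert : ∀ η : ℝ, η ≠ 0 → rateL25 η - (2 * π - δ) * |η| ≤ M)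
    {n : ℕ} (hn : 3 ≤ n) :
    ∫ y : ℝ, ‖ratRCL25 n ((uLineL25 n : ℂ) + (y : ℂ) * I)‖ / Real.cosh (π * y) ^ 2 ≤
      4 * Real.exp K0L25 * (n : ℝ) ^ 2 * Real.exp (n * M) * ∫ y : ℝ, (484 + y ^ 2) ^ 9 * Real.exp (-(δ * |y|)) := by
  rw [← integral_const_mul]
  refine integral_mono_of_nonneg (Filter.Eventually.of_forall fun y => by positivity)
    ((integrable_poly_exp hδ).const_mul _) ?_
  have h0 : ∀ᵐ y : ℝ ∂volume, y ≠ 0 := by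
    have : (volume : Measure ℝ) {0} = 0 := measure_singleton 0
    filter_upwards [measure_eq_zero_iff_ae_notMem.1 this] with y hy
    simpa using hy
  filter_upwards [h0] with y hy
  have := lineIntegrandL25_le hcert hn hy
  calc ‖ratRCL25 n ((uLineL25 n : ℂ) + (y : ℂ) * I)‖ / Real.cosh (π * y) ^ 2
      ≤ 4 * Real.exp K0L25 * (n : ℝ) ^ 2 * (484 + y ^ 2) ^ 9 * Real.exp (n * M) * Real.exp (-(δ * |y|)) := this
    _ = 4 * Real.exp K0L25 * (n : ℝ) ^ 2 * Real.exp (n * M) * ((484 + y ^ 2) ^ 9 * Real.exp (-(δ * |y|))) := by ring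

/-- **`DecayL25 c` from the certificate**: if for some `δ > 0` and `M` the explicit rate function satisfies
`rateL25 η − (2π − δ)|η| ≤ M` for all `η ≠ 0`, then `DecayL25 c` holds for every `c < −M`
(line representation, strip shift, line bound and `dy`-assembly all PROVED; only the one-variable inequality is an
input — `TwoTaleL25LineCertificate.certL25_delta` supplies it with `M = −71.441797 + 33δ`). -/
theorem decayL25_of_certificate (hδ : 0 < δ) (hcert : ∀ η : ℝ, η ≠ 0 → rateL25 η - (2 * π - δ) * |η| ≤ M) {c : ℝ}
    (hc : c < -M) : DecayL25 c := by
  refine decayL25_of_halfLineBound xLineL25 xLineL25_le ?_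
  set ε : ℝ := -M - c with hεdef
  have hε : 0 < ε := by rw [hεdef]; linarith
  set A : ℝ := 4 * Real.exp K0L25 * ∫ y : ℝ, (484 + y ^ 2) ^ 9 * Real.exp (-(δ * |y|)) with hA
  have hA0 : 0 ≤ A := by
    rw [hA]; exact mul_nonneg (by positivity) (integral_nonneg fun y => by positivity)
  -- eventually: (π/2)·A·(8/ε²) ≤ e^{εn/2}
  have hev : ∀ᶠ n : ℕ in atTop, π / 2 * A * (8 / ε ^ 2) ≤ Real.exp (ε / 2 * n) := by
    have ht : Tendsto (fun n : ℕ => Real.exp (ε / 2 * n)) atTop atTop :=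
      Real.tendsto_exp_atTop.comp (tendsto_natCast_atTop_atTop.const_mul_atTop (by positivity))
    exact ht.eventually_ge_atTop _
  have hev3 : ∀ᶠ n : ℕ in atTop, 3 ≤ n := Filter.eventually_ge_atTop 3
  filter_upwards [hev, hev3] with n hK hn3
  have hn0 : (0 : ℝ) < n := by exact_mod_cast (show 0 < n by omega)
  -- rewrite the integrand's argument to `uLineL25 n + y I`
  have harg : ∀ y : ℝ, ((((xLineL25 n : ℝ) + 1 / 2 : ℝ) : ℂ) - (27 * n + 1) + (y : ℂ) * I) =
      ((uLineL25 n : ℂ) + (y : ℂ) * I) := fun y => by unfold uLineL25; push_cast; ring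
  simp_rw [harg]
  have hI := integral_lineIntegrandL25_le hδ hcert hn3
  have hsq := sq_le_exp hε n
  have hpi : 0 < π / 2 := by positivity
  calc π / 2 * ∫ y : ℝ, ‖ratRCL25 n ((uLineL25 n : ℂ) + (y : ℂ) * I)‖ / Real.cosh (π * y) ^ 2
      ≤ π / 2 * (4 * Real.exp K0L25 * (n : ℝ) ^ 2 * Real.exp (n * M) *
          ∫ y : ℝ, (484 + y ^ 2) ^ 9 * Real.exp (-(δ * |y|))) := mul_le_mul_of_nonneg_left hI hpi.le
    _ = π / 2 * A * (n : ℝ) ^ 2 * Real.exp (n * M) := by rw [hA]; ring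
    _ ≤ π / 2 * A * (8 / ε ^ 2 * Real.exp (ε / 2 * n)) * Real.exp (n * M) := by gcongr
    _ = (π / 2 * A * (8 / ε ^ 2)) * Real.exp (ε / 2 * n) * Real.exp (n * M) := by ring
    _ ≤ Real.exp (ε / 2 * n) * Real.exp (ε / 2 * n) * Real.exp (n * M) := by gcongr
    _ = Real.exp (-(c * n)) := by
        rw [← Real.exp_add, ← Real.exp_add]; congr 1; rw [hεdef]; ring

/-! ### The final one-variable step: `DecayL25 c` for every `c < 71.441797` -/

/-- **The two normalisations agree**: `rateL25 η = profileL250 (127/10) η`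
(`V* = 127/10 + (5, −27 | 0, −22 | −5, −17 ‖ 37, 10)`, `39 + κ_L25 = profileL25Const`). -/
theorem rateL25_eq (η : ℝ) : rateL25 η = profileL250 (127 / 10) η := by
  simp only [rateL25, kappaL25, profileL250, profileL25Const, prim_eq_gPrim]
  norm_num
  ring

/-- **`DecayL25 c` for every `c < 71.441797`** (kernel certificate `certL25_delta` + the `dy`-assembly above, with
`δ = min 4 ((71.441797 − c)/66)`, `M = −71.441797 + 33δ ≤ −(71.441797 + c)/2 < −c`). -/
theorem decayL25_of_lt {c : ℝ} (hc : c < 71.441797) : DecayL25 c := by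
  have hδ0 : 0 < min 4 ((71.441797 - c) / 66) := lt_min (by norm_num) (by linarith)
  have hδ4 : min 4 ((71.441797 - c) / 66) ≤ 4 := min_le_left _ _
  have hδc : min 4 ((71.441797 - c) / 66) ≤ (71.441797 - c) / 66 := min_le_right _ _
  refine decayL25_of_certificate hδ0 (M := -71.441797 + 33 * min 4 ((71.441797 - c) / 66)) (fun η hη => ?_)
    (by linarith)
  rw [rateL25_eq]
  exact certL25_delta hδ0.le hδ4 η hη

/-- **`DecayL25 71.44179` PROVED** (sharp form; design saddle `C₀ = 71.44179775`). -/
theorem decayL25_holds_sharp : DecayL25 71.44179 := decayL25_of_lt (by norm_num)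

/-- `DecayL25 71.4417`. -/
theorem decayL25_holds : DecayL25 71.4417 := decayL25_of_lt (by norm_num)

end Summit.KontsevichZagierPeriods.Zeta5Search.TwoTaleL25Line

end
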